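import Literature.AlgebraicGeometry.Frobenioids.PadicFieldwiseSaturatedCriterion
import HarnessLib

/-!
# Frobenioids II, Theorem 2.4 (i), proof p. 20 ll. 22–28: «(a) and (b) are preserved by `Ψ`. Thus, `Φ₁` is
# fieldwise saturated if and only if `Φ₂` is» — the transport (PROOFS; the `hfs` input of `Thm24i`)

Mochizuki, *The geometry of Frobenioids II*, Kyushu J. Math. **62** (2008) 401–460, §2, proof of Theorem 2.4 (i),
journal p. 417 ll. 22–28 = author's text p. 20 [cite: MochizukiFrdII2008, Thm 2.4 (i) p.20]:

> "Moreover, since `Cᵢ` is a Frobenioid of rationally standard type … over a slim base category …, it follows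
> from [Mzk5, Corollaries 4.10 and 4.11(ii), (iii)], that `Ψ` induces a 1-compatible equivalence of categories
> `Ψ^Base : D₁ ⥲ D₂`, as well as compatible isomorphisms of functors `Φ₁ ⥲ Φ₂`, `B₁ ⥲ B₂` — where we regard
> '`O^⊳(−)`' as a subfunctor of `Bᵢ` (such that `Bᵢ` is the groupification of '`O^⊳(−)`') which is preserved by the
> isomorphism `B₁ ⥲ B₂` — hence that these conditions (a) and (b) are preserved by `Ψ`. Thus, `Φ₁` is fieldwise
> saturated if and only if `Φ₂` is."

PROOF-ONLY file (abc-iut cell, seat abc-iut-w5-d229; SUBDAG-FrdII-Thm24 row **L03 `hfs`**: the hypothesis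
`hfs : fs₁ ↔ fs₂` of abc-iut-L1-d4's `Def22Context.Iso.thm24i_of_inputs` / abc-iut-L1-t7's `thm24i_of_cupProduct` at
the binding `fsᵢ := dᵢ.IsFieldwiseSaturated`; no definitions). The [FrdI] Cor. 4.10 / 4.11 (ii)(iii) outputs enter
BY NAME as binders (row L02 of the sub-DAG): an equivalence `E : D₁ ≌ D₂` of the bases (`Ψ^Base`), monoid
isomorphisms `φ_X : Φ₁(X) ≃* Φ₂(Ψ^Base X)` natural in `X` (`Ψ^Φ`; the shape of abc-iut-L1's
`DivisorMonoidIsoOverBase`), and `β_X : B₁(X) ≃* B₂(Ψ^Base X)` natural in `X` and compatible with `Div_B` (the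
birationalised `Ψ^Φ` of Cor. 4.10, "preserving `O^⊳(−)`").

**Mechanism (no transport of Galois coverings is needed).** For `C₂ ∈ Ob(D₂)` write `C₂ ≅ Ψ^Base C₁`; an effective
multiple `[μ₂] = ord(π_{C₂})^m` is pulled back to `μ₁ ∈ Φ₁(C₁)` through `φ`; (a) on side 1 and a Galois closure on
side 1 (`hdom₁`) give an `m`-th root `y₁` of `Φ₁(f₁) μ₁` over a GALOIS `f₁ : B₁ → C₁` OF `D₁`, pushed forward to an
`m`-th root of `Φ₂(f₂) μ₂` over `f₂ := Ψ^Base f₁ ≫ (C₂ ≅ Ψ^Base C₁)⁻¹`; descent along `f₂` of an effective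
`Gal`-fixed `b₂ ∈ B₂(Ψ^Base B₁)` is obtained by pulling `b₂` back through `β`, descending on side 1 by (b) along the
Galois `f₁`, and pushing the result forward through `β` (naturality + `Div_B`-compatibility keep effectivity and the
`K^×`-components). Then `PadicFrd.Datum.ordUnitsSubgroup_le_of_root_of_descent` (the side-2 mechanism of L01)
concludes. Hence: (a)₁ ∧ (b)₁ ∧ `hdom₁` ⇒ `Φ₂` fieldwise saturated (`isFieldwiseSaturated_of_transport`); with L01's
`Φ₁` fieldwise saturated ⇒ (a)₁ ∧ (b)₁ (`hram₁`, `hfix₁`) one gets `isFieldwiseSaturated_transport`, and applying it to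
`Ψ` and to `Ψ⁻¹` the printed «`Φ₁` is fieldwise saturated if and only if `Φ₂` is» (`isFieldwiseSaturated_iff_of_equiv`,
the comparison data for `Ψ⁻¹` being binders as well — both are instances of the same Cor. 4.11 output).
Classical; nothing here bears on [IUTchIII] Cor. 3.12; no statement of the paper is strengthened.
-/

noncomputable section

namespace Literature.AlgebraicGeometry.Frobenioids

open CategoryTheory Opposite Function

universe v u

namespace PadicFrd

namespace Datum

variable {D₁ D₂ : Type u} [Category.{v} D₁] [Category.{v} D₂] {p₁ p₂ : ℕ} [Fact p₁.Prime] [Fact p₂.Prime]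
  (d₁ : Datum D₁ p₁) (d₂ : Datum D₂ p₂)

/-- **[FrdII] Thm. 2.4 (i), proof p. 20: «(a) and (b) are preserved by `Ψ`» — the working form.** Comparison data
from side 1 to side 2: a functor `F : D₁ ⥤ D₂` reaching every object of `D₂` up to isomorphism (`G`, `e`), monoid
isomorphisms `φ_X : Φ₁(X) ≃* Φ₂(F X)` and `β_X : B₁(X) ≃* B₂(F X)` natural in `X` and compatible with `Div_B`. Then
(a) and (b) on side 1 (for a class `Gal₁` with Galois closures, `hdom₁`) imply that `Φ₂` is fieldwise saturated.
[cite: MochizukiFrdII2008, Thm 2.4 (i) p.20] -/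
theorem isFieldwiseSaturated_of_transport (F : D₁ ⥤ D₂) (G : D₂ → D₁) (e : ∀ X₂ : D₂, F.obj (G X₂) ≅ X₂)
    (φ : ∀ X : D₁, d₁.Φ.obj (op X) ≃* d₂.Φ.obj (op (F.obj X)))
    (hφ : ∀ ⦃X Y : D₁⦄ (f : Y ⟶ X) (x : d₁.Φ.obj (op X)),
      φ Y ((d₁.Φ.map f.op).hom x) = (d₂.Φ.map (F.map f).op).hom (φ X x))
    (β : ∀ X : D₁, d₁.B.obj (op X) ≃* d₂.B.obj (op (F.obj X)))
    (hβ : ∀ ⦃X Y : D₁⦄ (f : Y ⟶ X) (b : d₁.B.obj (op X)),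
      β Y ((d₁.B.map f.op).hom b) = (d₂.B.map (F.map f).op).hom (β X b))
    (hβdiv : ∀ (X : D₁) (b : d₁.B.obj (op X)),
      Frobenioids.divB d₂.Φ d₂.B d₂.divB (op (F.obj X)) (β X b) =
        MonGp.map (φ X).toMonoidHom (Frobenioids.divB d₁.Φ d₁.B d₁.divB (op X) b))
    (Gal₁ : ∀ ⦃B C : D₁⦄, (B ⟶ C) → Prop)
    (hdom₁ : ∀ ⦃B₁ C : D₁⦄ (f₁ : B₁ ⟶ C), ∃ (B : D₁) (g : B ⟶ B₁), Gal₁ (g ≫ f₁))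
    (hdiv₁ : ∀ (C : D₁) (x : d₁.Φ.obj (op C)) (n : ℕ), 0 < n →
      ∃ (B : D₁) (f : B ⟶ C) (y : d₁.Φ.obj (op B)), y ^ n = (d₁.Φ.map f.op).hom x)
    (hdesc₁ : ∀ ⦃B C : D₁⦄ (f : B ⟶ C), Gal₁ f → ∀ b : d₁.B.obj (op B),
      (∃ y : d₁.Φ.obj (op B), Frobenioids.divB d₁.Φ d₁.B d₁.divB (op B) b = Algebra.GrothendieckGroup.of y) →
      (∀ σ : B ⟶ B, σ ≫ f = f → (d₁.B.map σ.op).hom b = b) →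
      ∃ c : d₁.B.obj (op C),
        (∃ z : d₁.Φ.obj (op C), Frobenioids.divB d₁.Φ d₁.B d₁.divB (op C) c = Algebra.GrothendieckGroup.of z) ∧
        (d₁.B.map f.op).hom c = b) :
    d₂.IsFieldwiseSaturated := by
  intro C₂
  set C₁ : D₁ := G C₂ with hC₁
  set e₂ : F.obj C₁ ≅ C₂ := e C₂ with he₂
  obtain ⟨π, -, hπ⟩ := d₂.exists_uniformizer C₂
  obtain ⟨m, μ₂, hm, hμ₂⟩ := d₂.exists_pow_generator_eq_phiGp C₂ hπ
  -- pull `μ₂` back to side 1, take an `m`-th root there over a Galois arrow, push forward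
  set μ₁ : d₁.Φ.obj (op C₁) := (φ C₁).symm ((d₂.Φ.map e₂.hom.op).hom μ₂) with hμ₁
  obtain ⟨B₁', f₁', y₁', hy₁'⟩ := hdiv₁ C₁ μ₁ m hm
  obtain ⟨B₁, g₁, hgal⟩ := hdom₁ f₁'
  set f₁ : B₁ ⟶ C₁ := g₁ ≫ f₁' with hf₁
  set y₁ : d₁.Φ.obj (op B₁) := (d₁.Φ.map g₁.op).hom y₁' with hy₁_def
  have hy₁ : y₁ ^ m = (d₁.Φ.map f₁.op).hom μ₁ := by
    rw [hy₁_def, ← map_pow, hy₁', hf₁, op_comp, d₁.Φ.map_comp, CommMonCat.comp_apply]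
  set f₂ : F.obj B₁ ⟶ C₂ := F.map f₁ ≫ e₂.hom with hf₂
  have hy₂ : (φ B₁ y₁) ^ m = (d₂.Φ.map f₂.op).hom μ₂ := by
    rw [← map_pow, hy₁, hφ, hμ₁, MulEquiv.apply_symm_apply, hf₂, op_comp, d₂.Φ.map_comp, CommMonCat.comp_apply]
  -- descent along `f₂` on side 2, through side 1
  refine d₂.ordUnitsSubgroup_le_of_root_of_descent C₂ hπ hm hμ₂ f₂ hy₂ ?_
  intro b₂ hb₂ hinv₂
  obtain ⟨y₂, hy₂b⟩ := hb₂
  haveI : IsCancelMul (d₂.Φ.obj (op (F.obj B₁))) := (d₂.isMonoprime (op (F.obj B₁))).isCancelMul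
  set b₁ : d₁.B.obj (op B₁) := (β B₁).symm b₂ with hb₁
  have hβb₁ : β B₁ b₁ = b₂ := by rw [hb₁, MulEquiv.apply_symm_apply]
  -- `b₁` is effective
  have hb₁eff : Frobenioids.divB d₁.Φ d₁.B d₁.divB (op B₁) b₁ = Algebra.GrothendieckGroup.of ((φ B₁).symm y₂) := by
    apply MonGp.map_injective (φ B₁).toMonoidHom (φ B₁).injective
    rw [← hβdiv, hβb₁, hy₂b, MonGp.map_of, MulEquiv.coe_toMonoidHom, MulEquiv.apply_symm_apply]
  -- `b₁` is fixed by the endomorphisms of `B₁` over `C₁`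
  have hinv₁ : ∀ σ : B₁ ⟶ B₁, σ ≫ f₁ = f₁ → (d₁.B.map σ.op).hom b₁ = b₁ := by
    intro σ hσ
    apply (β B₁).injective
    rw [hβ, hβb₁]
    apply hinv₂
    rw [hf₂, ← Category.assoc, ← F.map_comp, hσ]
  obtain ⟨c₁, ⟨z₁, hc₁z⟩, hc₁b⟩ := hdesc₁ f₁ hgal b₁ ⟨_, hb₁eff⟩ hinv₁
  -- push the descended element forward and correct by the iso `e₂`
  refine ⟨(d₂.B.map e₂.inv.op).hom (β C₁ c₁), ⟨(d₂.Φ.map e₂.inv.op).hom (φ C₁ z₁), ?_⟩, ?_⟩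
  · rw [d₂.divB_mapB e₂.inv, hβdiv, hc₁z, MonGp.map_of, pullGp_of, MulEquiv.coe_toMonoidHom]
  · rw [← CommMonCat.comp_apply, ← d₂.B.map_comp, ← op_comp, hf₂, Category.assoc, e₂.hom_inv_id,
      Category.comp_id, ← hβ, hc₁b, hβb₁]

/-- **[FrdII] Thm. 2.4 (i), proof p. 20: `Φ₁` fieldwise saturated ⇒ `Φ₂` fieldwise saturated** along the
Cor. 4.10/4.11 comparison data `(Ψ^Base, Ψ^Φ, Ψ^B)` (`F` reaching every object of `D₂` up to isomorphism), for a
side-1 base with Galois closures (`hdom₁`), Galois theory (`hfix₁`) and ramified covers of every index (`hram₁`)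
— combining «fieldwise saturated ⇒ (a), (b)» on side 1 (L01) with the transport of (a), (b).
[cite: MochizukiFrdII2008, Thm 2.4 (i) p.20] -/
theorem isFieldwiseSaturated_transport (F : D₁ ⥤ D₂) (G : D₂ → D₁) (e : ∀ X₂ : D₂, F.obj (G X₂) ≅ X₂)
    (φ : ∀ X : D₁, d₁.Φ.obj (op X) ≃* d₂.Φ.obj (op (F.obj X)))
    (hφ : ∀ ⦃X Y : D₁⦄ (f : Y ⟶ X) (x : d₁.Φ.obj (op X)),
      φ Y ((d₁.Φ.map f.op).hom x) = (d₂.Φ.map (F.map f).op).hom (φ X x))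
    (β : ∀ X : D₁, d₁.B.obj (op X) ≃* d₂.B.obj (op (F.obj X)))
    (hβ : ∀ ⦃X Y : D₁⦄ (f : Y ⟶ X) (b : d₁.B.obj (op X)),
      β Y ((d₁.B.map f.op).hom b) = (d₂.B.map (F.map f).op).hom (β X b))
    (hβdiv : ∀ (X : D₁) (b : d₁.B.obj (op X)),
      Frobenioids.divB d₂.Φ d₂.B d₂.divB (op (F.obj X)) (β X b) =
        MonGp.map (φ X).toMonoidHom (Frobenioids.divB d₁.Φ d₁.B d₁.divB (op X) b))
    (Gal₁ : ∀ ⦃B C : D₁⦄, (B ⟶ C) → Prop)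
    (hdom₁ : ∀ ⦃B₁ C : D₁⦄ (f₁ : B₁ ⟶ C), ∃ (B : D₁) (g : B ⟶ B₁), Gal₁ (g ≫ f₁))
    (hfix₁ : ∀ ⦃B C : D₁⦄ (f : B ⟶ C), Gal₁ f → ∀ x : d₁.fld B,
      (∀ σ : B ⟶ B, σ ≫ f = f → (d₁.base.map σ).alg x = x) → ∃ x₀ : d₁.fld C, (d₁.base.map f).alg x₀ = x)
    (hram₁ : ∀ (C : D₁) (N : ℕ), 0 < N → ∃ (B : D₁) (f : B ⟶ C), ∀ a : OrdInt (d₁.fld C),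
      ∃ b : OrdInt (d₁.fld B), ordIntMapOfHom (d₁.base.map f).alg (d₁.base.map f).isValHom a = b ^ N)
    (hfs₁ : d₁.IsFieldwiseSaturated) : d₂.IsFieldwiseSaturated :=
  isFieldwiseSaturated_of_transport d₁ d₂ F G e φ hφ β hβ hβdiv Gal₁ hdom₁
    (d₁.divisible_of_isFieldwiseSaturated hfs₁ hram₁)
    (fun _ _ f hf b hb hinv => d₁.descent_of_isFieldwiseSaturated hfs₁ Gal₁ hfix₁ f hf b hb hinv)

/-- **[FrdII] Thm. 2.4 (i), proof p. 20: «Thus, `Φ₁` is fieldwise saturated if and only if `Φ₂` is»** — the `hfs`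
input of the typed Theorem 2.4 (i) (`PadicKummer.Thm24i`, first conjunct) at the binding
`fsᵢ := dᵢ.IsFieldwiseSaturated`, from the equivalence `Ψ^Base : D₁ ⥲ D₂` with the compatible isomorphisms
`Φ₁ ⥲ Φ₂`, `B₁ ⥲ B₂` of [FrdI] Cor. 4.10 / 4.11 (ii)(iii) (binders, for `Ψ` and for `Ψ⁻¹`; row L02) over two bases of
the printed kind (`B^temp(Πᵢ, Πᵢ°)⁰`: Galois closures, Galois theory, ramified covers — binders).
[cite: MochizukiFrdII2008, Thm 2.4 (i) p.20] -/
theorem isFieldwiseSaturated_iff_of_equiv (E : D₁ ≌ D₂)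
    (φ : ∀ X : D₁, d₁.Φ.obj (op X) ≃* d₂.Φ.obj (op (E.functor.obj X)))
    (hφ : ∀ ⦃X Y : D₁⦄ (f : Y ⟶ X) (x : d₁.Φ.obj (op X)),
      φ Y ((d₁.Φ.map f.op).hom x) = (d₂.Φ.map (E.functor.map f).op).hom (φ X x))
    (β : ∀ X : D₁, d₁.B.obj (op X) ≃* d₂.B.obj (op (E.functor.obj X)))
    (hβ : ∀ ⦃X Y : D₁⦄ (f : Y ⟶ X) (b : d₁.B.obj (op X)),
      β Y ((d₁.B.map f.op).hom b) = (d₂.B.map (E.functor.map f).op).hom (β X b))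
    (hβdiv : ∀ (X : D₁) (b : d₁.B.obj (op X)),
      Frobenioids.divB d₂.Φ d₂.B d₂.divB (op (E.functor.obj X)) (β X b) =
        MonGp.map (φ X).toMonoidHom (Frobenioids.divB d₁.Φ d₁.B d₁.divB (op X) b))
    (φ' : ∀ X : D₂, d₂.Φ.obj (op X) ≃* d₁.Φ.obj (op (E.inverse.obj X)))
    (hφ' : ∀ ⦃X Y : D₂⦄ (f : Y ⟶ X) (x : d₂.Φ.obj (op X)),
      φ' Y ((d₂.Φ.map f.op).hom x) = (d₁.Φ.map (E.inverse.map f).op).hom (φ' X x))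
    (β' : ∀ X : D₂, d₂.B.obj (op X) ≃* d₁.B.obj (op (E.inverse.obj X)))
    (hβ' : ∀ ⦃X Y : D₂⦄ (f : Y ⟶ X) (b : d₂.B.obj (op X)),
      β' Y ((d₂.B.map f.op).hom b) = (d₁.B.map (E.inverse.map f).op).hom (β' X b))
    (hβ'div : ∀ (X : D₂) (b : d₂.B.obj (op X)),
      Frobenioids.divB d₁.Φ d₁.B d₁.divB (op (E.inverse.obj X)) (β' X b) =
        MonGp.map (φ' X).toMonoidHom (Frobenioids.divB d₂.Φ d₂.B d₂.divB (op X) b))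
    (Gal₁ : ∀ ⦃B C : D₁⦄, (B ⟶ C) → Prop) (Gal₂ : ∀ ⦃B C : D₂⦄, (B ⟶ C) → Prop)
    (hdom₁ : ∀ ⦃B₁ C : D₁⦄ (f₁ : B₁ ⟶ C), ∃ (B : D₁) (g : B ⟶ B₁), Gal₁ (g ≫ f₁))
    (hfix₁ : ∀ ⦃B C : D₁⦄ (f : B ⟶ C), Gal₁ f → ∀ x : d₁.fld B,
      (∀ σ : B ⟶ B, σ ≫ f = f → (d₁.base.map σ).alg x = x) → ∃ x₀ : d₁.fld C, (d₁.base.map f).alg x₀ = x)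
    (hram₁ : ∀ (C : D₁) (N : ℕ), 0 < N → ∃ (B : D₁) (f : B ⟶ C), ∀ a : OrdInt (d₁.fld C),
      ∃ b : OrdInt (d₁.fld B), ordIntMapOfHom (d₁.base.map f).alg (d₁.base.map f).isValHom a = b ^ N)
    (hdom₂ : ∀ ⦃B₁ C : D₂⦄ (f₁ : B₁ ⟶ C), ∃ (B : D₂) (g : B ⟶ B₁), Gal₂ (g ≫ f₁))
    (hfix₂ : ∀ ⦃B C : D₂⦄ (f : B ⟶ C), Gal₂ f → ∀ x : d₂.fld B,
      (∀ σ : B ⟶ B, σ ≫ f = f → (d₂.base.map σ).alg x = x) → ∃ x₀ : d₂.fld C, (d₂.base.map f).alg x₀ = x)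
    (hram₂ : ∀ (C : D₂) (N : ℕ), 0 < N → ∃ (B : D₂) (f : B ⟶ C), ∀ a : OrdInt (d₂.fld C),
      ∃ b : OrdInt (d₂.fld B), ordIntMapOfHom (d₂.base.map f).alg (d₂.base.map f).isValHom a = b ^ N) :
    d₁.IsFieldwiseSaturated ↔ d₂.IsFieldwiseSaturated :=
  ⟨isFieldwiseSaturated_transport d₁ d₂ E.functor E.inverse.obj (fun X₂ => E.counitIso.app X₂) φ hφ β hβ hβdiv
      Gal₁ hdom₁ hfix₁ hram₁,
    isFieldwiseSaturated_transport d₂ d₁ E.inverse E.functor.obj (fun X₁ => (E.unitIso.app X₁).symm) φ' hφ' β' hβ'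
      hβ'div Gal₂ hdom₂ hfix₂ hram₂⟩

end Datum

end PadicFrd

end Literature.AlgebraicGeometry.Frobenioids

end
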